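import Literature.NumberTheory.EllipticCurves.TamagawaSubgroupProofs
import Literature.NumberTheory.EllipticCurves.TamagawaVariableChangeProofs
import Literature.NumberTheory.EllipticCurves.LocalIndexBadPoints
import Literature.NumberTheory.EllipticCurves.BSDRootNumberPrimesEquivProofs
import Literature.NumberTheory.EllipticCurves.FrobeniusTwist
import HarnessLib

/-!
# Tamagawa numbers are invariants of the discretely valued field (proofs)

Sibling *proofs* file (theorems only: no definition, no named fact, no instance) of
`Literature.NumberTheory.EllipticCurves.Tamagawa`, discharging the named fact
`WeierstrassCurve.localTamagawaNumber_padic_eq` stated there (D-0014): for an elliptic curve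
`W / ℚ`, a finite place `v` of `𝓞 ℚ` and the rational prime `p = primesEquiv v` under it, the local
Tamagawa number `c(W / ℚ_[p]) = [E(ℚ_p) : E₀(ℚ_p)]` computed with Mathlib's `ℚ_[p] ⊇ ℤ_[p]` equals
the factor `c_v = [E(ℚ_v) : E₀(ℚ_v)]` of `tamagawaProduct`, computed with the completion
`ℚ_v = v.adicCompletion ℚ ⊇ 𝓞_v`.

Mathematically this is the remark that `c(E/K) = [E(K) : E₀(K)]` is attached to the elliptic curve
`E` over the discretely valued field `K` (Silverman, *The Arithmetic of Elliptic Curves*, 2nd ed.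
(2009), VII.6 and Ex. 7.6; it is computed on a minimal equation, and two minimal equations differ
by `u ∈ R*`, `r, s, t ∈ R`, VII.1 Prop. 1.3(b), a change of coordinates which commutes with
reduction, VII.2), hence is transported along any isomorphism of discretely valued fields — here
Mathlib's `Rat.HeightOneSpectrum.adicCompletion.padicEquiv v : ℚ_v ≃ₐ[ℚ] ℚ_[p]`, which restricts to
`adicCompletionIntegers.padicIntEquiv v : 𝓞_v ≃ ℤ_[p]`. We prove the general transport statement
and specialise:

* `WeierstrassCurve.baseChange_map_ringEquiv`, `WeierstrassCurve.map_residue_ringEquiv` — for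
  compatible ring isomorphisms `ψ : R₁ ≃+* R₂`, `φ : K₁ ≃+* K₂` (`φ ∘ algebraMap = algebraMap ∘ ψ`)
  and an `R₁`-model `I`: `(I ⊗ K₁).map φ = (ψ I) ⊗ K₂` and `ψ I mod 𝔪₂ = (I mod 𝔪₁).map κ` for the
  induced isomorphism of residue fields `κ = ResidueField.mapEquiv ψ`;
* `WeierstrassCurve.hasNonsingularReduction_mapPoint_ringEquiv_iff` — the bijection
  `(x, y) ↦ (φ x, φ y)` of `K₁`-points of `I` onto `K₂`-points of `ψ I` (the tree's
  `WeierstrassCurve.mapPoint`) preserves and reflects "nonsingular reduction" (`E₀`), because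
  integrality corresponds under `φ` and nonsingularity of the reduced point under `κ`;
* `WeierstrassCurve.index_nonsingularReductionSubgroup_map_ringEquiv` — hence
  `[E(K₂) : E₀(K₂)] = [E(K₁) : E₀(K₁)]` for `ψ I` and `I`;
* `WeierstrassCurve.localTamagawaNumber_map_ringEquiv` — **`c((X.map φ) / K₂) = c(X / K₁)`** for an
  elliptic `X / K₁`: the image under `φ` of the chosen `R₁`-minimal model of `X` is an `R₂`-minimal
  equation (`isMinimal_map_iff`) `K₂`-isomorphic to the chosen `R₂`-minimal model of `X.map φ`, and
  the index does not depend on the minimal equation (`index_goodReductionSubgroup_eq_of_eq_smul`,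
  Silverman VII.1.3(b));
* `WeierstrassCurve.localTamagawaNumber_padic_eq_holds` — the discharge, `φ = padicEquiv v`.

## References

* [SilvermanAEC2009] J. H. Silverman, *The Arithmetic of Elliptic Curves*, GTM 106, 2nd ed.
  (2009): VII.1 Prop. 1.3(b) (PDF p. 165); VII.2, the reduction map and Prop. 2.1 (PDF pp. 166–167);
  VII.6 and Ex. 7.6.
-/

noncomputable section

open scoped Classical

namespace WeierstrassCurve

open IsLocalRing Literature.NumberTheory.EllipticCurves

/-! ### Transport along an isomorphism of discretely valued fields -/

section Transport

variable {R₁ K₁ R₂ K₂ : Type*}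
  [CommRing R₁] [IsDomain R₁] [IsDiscreteValuationRing R₁] [Field K₁] [Algebra R₁ K₁]
  [IsFractionRing R₁ K₁]
  [CommRing R₂] [IsDomain R₂] [IsDiscreteValuationRing R₂] [Field K₂] [Algebra R₂ K₂]
  [IsFractionRing R₂ K₂]
  (ψ : R₁ ≃+* R₂) (φ : K₁ ≃+* K₂)
  (hc : ∀ r : R₁, φ (algebraMap R₁ K₁ r) = algebraMap R₂ K₂ (ψ r))

include hc in
omit [IsDomain R₁] [IsDiscreteValuationRing R₁] [IsFractionRing R₁ K₁] [IsDomain R₂]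
  [IsDiscreteValuationRing R₂] [IsFractionRing R₂ K₂] in
/-- For compatible `ψ : R₁ ≃+* R₂`, `φ : K₁ ≃+* K₂` and an `R₁`-model `I`:
`(I ⊗ K₁).map φ = (ψ I) ⊗ K₂` (both are `I` mapped along `φ ∘ algebraMap = algebraMap ∘ ψ`).
[folklore] -/
theorem baseChange_map_ringEquiv (I : WeierstrassCurve R₁) :
    (I.baseChange K₁).map (φ : K₁ →+* K₂) = (I.map (ψ : R₁ →+* R₂)).baseChange K₂ := by
  rw [baseChange, baseChange, map_map, map_map]
  congr 1
  ext r
  exact hc r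

omit [IsDomain R₁] [IsDiscreteValuationRing R₁] [IsDomain R₂] [IsDiscreteValuationRing R₂] in
/-- For `ψ : R₁ ≃+* R₂` (local rings) and an `R₁`-model `I`: the reduction of `ψ I` modulo `𝔪₂` is
the reduction of `I` modulo `𝔪₁` mapped along the induced isomorphism of residue fields
`κ = ResidueField.mapEquiv ψ` (`residue ∘ ψ = κ ∘ residue`). [folklore] -/
theorem map_residue_ringEquiv [IsLocalRing R₁] [IsLocalRing R₂] (ψ : R₁ ≃+* R₂)
    (I : WeierstrassCurve R₁) :
    (I.map (ψ : R₁ →+* R₂)).map (residue R₂) =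
      (I.map (residue R₁)).map
        ((ResidueField.mapEquiv ψ : ResidueField R₁ ≃+* ResidueField R₂) :
          ResidueField R₁ →+* ResidueField R₂) := by
  rw [map_map, map_map]
  congr 1

include hc in
/-- **`E₀` is transported along an isomorphism of discretely valued fields.** For compatible
`ψ : R₁ ≃+* R₂`, `φ : K₁ ≃+* K₂` and an `R₁`-model `I`, a `K₁`-point `P` of `I` has nonsingular
reduction iff its image `(φ x, φ y)` on `ψ I` has: the point at infinity and the non-integral points
correspond (`φ x ∈ R₂ ↔ x ∈ R₁`), and for an integral point `(a, b)` the reduced point `(ā, b̄)` of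
`I mod 𝔪₁` is nonsingular iff its image under the residue-field isomorphism `κ` is nonsingular on
`(I mod 𝔪₁).map κ = ψ I mod 𝔪₂` (Mathlib `Affine.map_nonsingular`). Silverman, *AEC* VII.2 (the
reduction map is defined coordinatewise on a minimal equation).
[cite: SilvermanAEC2009, VII.2 (the reduction map, PDF pp. 166–167)] -/
theorem hasNonsingularReduction_mapPoint_ringEquiv_iff (I : WeierstrassCurve R₁)
    (P : (I.baseChange K₁).toAffine.Point) :
    (I.map (ψ : R₁ →+* R₂)).HasNonsingularReduction
        (mapPoint (φ : K₁ →+* K₂) (baseChange_map_ringEquiv ψ φ hc I) P) ↔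
      I.HasNonsingularReduction P := by
  have hv₁ := integers_valuationRing_valuation R₁ K₁
  -- integrality corresponds under `φ`
  have hrange : ∀ x : K₁, (φ : K₁ →+* K₂) x ∈ Set.range (algebraMap R₂ K₂) ↔
      x ∈ Set.range (algebraMap R₁ K₁) := fun x ↦ by
    rw [← RingHom.coe_range, ← RingHom.coe_range, SetLike.mem_coe, SetLike.mem_coe]
    exact ringEquiv_mem_range_algebraMap_iff ψ φ hc x
  rcases point_cases hv₁ P with rfl | ⟨x, y, h, rfl, hx⟩ | ⟨a, b, h, rfl⟩
  · rw [map_zero]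
    exact iff_of_true trivial trivial
  · rw [mapPoint_some]
    have hx' : x ∉ Set.range (algebraMap R₁ K₁) := (not_mem_range_iff hv₁).mpr hx
    exact iff_of_true (Or.inl fun hmem ↦ hx' ((hrange x).mp hmem)) (Or.inl hx')
  · rw [mapPoint_some, hasNonsingularReduction_some_algebraMap_iff (IsFractionRing.injective R₁ K₁) h,
      LocalIndex.hasNonsingularReduction_some_iff_of_eq (I.map (ψ : R₁ →+* R₂)) _
        (a := ψ a) (b := ψ b)
        (show (φ : K₁ →+* K₂) (algebraMap R₁ K₁ a) = algebraMap R₂ K₂ (ψ a) from hc a)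
        (show (φ : K₁ →+* K₂) (algebraMap R₁ K₁ b) = algebraMap R₂ K₂ (ψ b) from hc b),
      map_residue_ringEquiv ψ I]
    exact Affine.map_nonsingular _
      (ResidueField.mapEquiv ψ : ResidueField R₁ ≃+* ResidueField R₂).injective (residue R₁ a)
      (residue R₁ b)

include hc in
/-- **`[E(K) : E₀(K)]` is transported along an isomorphism of discretely valued fields**: for
compatible `ψ : R₁ ≃+* R₂`, `φ : K₁ ≃+* K₂` and an `R₁`-model `I`, the index of `E₀` in the
`K₂`-points of `ψ I` equals the index of `E₀` in the `K₁`-points of `I` — `E₀(K₁)` is the preimage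
of `E₀(K₂)` under the bijection `(x, y) ↦ (φ x, φ y)`
(`hasNonsingularReduction_mapPoint_ringEquiv_iff`). [folklore] -/
theorem index_nonsingularReductionSubgroup_map_ringEquiv (I : WeierstrassCurve R₁) :
    ((I.map (ψ : R₁ →+* R₂)).nonsingularReductionSubgroup
        (integers_valuationRing_valuation R₂ K₂)).index =
      (I.nonsingularReductionSubgroup (integers_valuationRing_valuation R₁ K₁)).index := by
  set f := mapPoint (φ : K₁ →+* K₂) (baseChange_map_ringEquiv ψ φ hc I) with hf
  have hcomap : I.nonsingularReductionSubgroup (integers_valuationRing_valuation R₁ K₁) =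
      ((I.map (ψ : R₁ →+* R₂)).nonsingularReductionSubgroup
        (integers_valuationRing_valuation R₂ K₂)).comap f := by
    ext P
    simp only [AddSubgroup.mem_comap, mem_nonsingularReductionSubgroup_iff]
    exact (hasNonsingularReduction_mapPoint_ringEquiv_iff ψ φ hc I P).symm
  rw [hcomap, AddSubgroup.index_comap_of_surjective _ (mapPoint_surjective _ _ φ.surjective)]

/-- Equal minimal equations have equal indices `[E(K) : E₀(K)]` (`IsMinimal` is a proposition;
used to move between propositionally equal models). [folklore] -/
theorem index_goodReductionSubgroup_congr_of_eq {X Y : WeierstrassCurve K₂} [X.IsMinimal R₂]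
    [Y.IsMinimal R₂] (h : X = Y) :
    (X.goodReductionSubgroup R₂).index = (Y.goodReductionSubgroup R₂).index := by
  subst h
  rfl

include ψ hc in
/-- **The local Tamagawa number is an invariant of the discretely valued field.** For compatible
ring isomorphisms `ψ : R₁ ≃+* R₂`, `φ : K₁ ≃+* K₂` of DVR / fraction-field pairs and an elliptic
curve `X / K₁`: `c((X.map φ) / K₂) = c(X / K₁)`. The image under `φ` of Mathlib's chosen
`R₁`-minimal model `M₁` of `X` is an `R₂`-minimal equation (`isMinimal_map_iff`) which is
`K₂`-isomorphic to the chosen `R₂`-minimal model of `X.map φ`, so both compute `c((X.map φ)/K₂)`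
(uniqueness of minimal equations up to `u ∈ R*`, `r, s, t ∈ R`, Silverman *AEC* VII.1 Prop. 1.3(b),
through `index_goodReductionSubgroup_eq_of_eq_smul`); and writing `M₁ = I ⊗ K₁`,
`M₁.map φ = ψ I ⊗ K₂`, the indices of `E₀` for `I` and `ψ I` agree
(`index_nonsingularReductionSubgroup_map_ringEquiv`). Silverman, *AEC* VII.6, Ex. 7.6 (`c` is
attached to `E / K`). [cite: SilvermanAEC2009, VII.1 Prop. 1.3(b) (PDF p. 165) and VII.6 Ex. 7.6] -/
theorem localTamagawaNumber_map_ringEquiv (X : WeierstrassCurve K₁) [X.IsElliptic] :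
    (X.map (φ : K₁ →+* K₂)).localTamagawaNumber R₂ = X.localTamagawaNumber R₁ := by
  have he := ringEquiv_mem_range_algebraMap_iff ψ φ hc
  -- the chosen minimal model of `X` over `R₁`, and an `R₁`-model `I` of it
  obtain ⟨C₁, hC₁⟩ : ∃ C : VariableChange K₁, X.minimal R₁ = C • X := ⟨_, rfl⟩
  haveI : (X.minimal R₁).IsElliptic := by rw [hC₁]; infer_instance
  obtain ⟨I, hI⟩ : ∃ I : WeierstrassCurve R₁, X.minimal R₁ = I.baseChange K₁ :=
    IsIntegral.integral
  -- the `K₁` side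
  have h₁ : X.localTamagawaNumber R₁ =
      (I.nonsingularReductionSubgroup (integers_valuationRing_valuation R₁ K₁)).index := by
    haveI : (I.baseChange K₁).IsMinimal R₁ := hI ▸ inferInstance
    change ((X.minimal R₁).goodReductionSubgroup R₁).index = _
    rw [index_goodReductionSubgroup_congr_of_eq hI, goodReductionSubgroup_baseChange_eq]
  -- the `K₂` side: `(X.map φ).minimal R₂ = D • (M₁.map φ)` with `M₁.map φ = ψ I ⊗ K₂` minimal
  haveI hmin : ((X.minimal R₁).map (φ : K₁ →+* K₂)).IsMinimal R₂ :=
    (isMinimal_map_iff φ he _).mpr inferInstance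
  obtain ⟨C₂, hC₂⟩ : ∃ C : VariableChange K₂,
      (X.map (φ : K₁ →+* K₂)).minimal R₂ = C • X.map (φ : K₁ →+* K₂) := ⟨_, rfl⟩
  have hrel : (X.map (φ : K₁ →+* K₂)).minimal R₂ =
      (C₂ * (C₁.map (φ : K₁ →+* K₂))⁻¹) • (X.minimal R₁).map (φ : K₁ →+* K₂) := by
    rw [hC₂, hC₁, ← map_variableChange, mul_smul, inv_smul_smul]
  have hΔ : ((X.minimal R₁).map (φ : K₁ →+* K₂)).Δ ≠ 0 :=
    ((X.minimal R₁).map (φ : K₁ →+* K₂)).isUnit_Δ.ne_zero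
  have hIφ : (X.minimal R₁).map (φ : K₁ →+* K₂) = (I.map (ψ : R₁ →+* R₂)).baseChange K₂ := by
    rw [hI, baseChange_map_ringEquiv ψ φ hc I]
  have h₂ : (X.map (φ : K₁ →+* K₂)).localTamagawaNumber R₂ =
      ((I.map (ψ : R₁ →+* R₂)).nonsingularReductionSubgroup
        (integers_valuationRing_valuation R₂ K₂)).index := by
    haveI : ((I.map (ψ : R₁ →+* R₂)).baseChange K₂).IsMinimal R₂ := hIφ ▸ hmin
    change (((X.map (φ : K₁ →+* K₂)).minimal R₂).goodReductionSubgroup R₂).index = _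
    rw [index_goodReductionSubgroup_eq_of_eq_smul R₂ hrel hΔ, index_goodReductionSubgroup_congr_of_eq hIφ,
      goodReductionSubgroup_baseChange_eq]
  rw [h₁, h₂, index_nonsingularReductionSubgroup_map_ringEquiv ψ φ hc I]

end Transport

/-! ### The isomorphism `ℚ_v ≃ ℚ_[p]`: discharge of `localTamagawaNumber_padic_eq` -/

section Padic

open IsDedekindDomain NumberField Rat.HeightOneSpectrum

/-- **Discharge of the named fact `WeierstrassCurve.localTamagawaNumber_padic_eq`**
(`Tamagawa.lean`): for an elliptic curve `W / ℚ`, a finite place `v` of `𝓞 ℚ` and the rational prime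
`p` with `primesEquiv v = p`, `c(W / ℚ_[p])` (over `ℤ_[p]`) equals the factor `c_v` of the Tamagawa
product (over `𝓞_v ⊆ ℚ_v`). Transport along Mathlib's `adicCompletion.padicEquiv v : ℚ_v ≃ₐ[ℚ] ℚ_[p]`
and `adicCompletionIntegers.padicIntEquiv v : 𝓞_v ≃ ℤ_[p]` (compatible by `rfl`; `ℚ →+* ℚ_[p]` is
unique, so `W / ℚ_v` is mapped to `W / ℚ_[p]`) by `localTamagawaNumber_map_ringEquiv`.
Silverman, *AEC* VII.6, Ex. 7.6 with VII.1, Prop. 1.3(b).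
[cite: SilvermanAEC2009, VII.6 Ex. 7.6 and VII.1 Prop. 1.3(b) (PDF p. 165)] -/
theorem localTamagawaNumber_padic_eq_holds : localTamagawaNumber_padic_eq := by
  intro W _ v p _ hv
  subst hv
  have hc : ∀ r : v.adicCompletionIntegers ℚ,
      (adicCompletion.padicEquiv v).toRingEquiv (algebraMap _ (v.adicCompletion ℚ) r) =
        algebraMap ℤ_[(primesEquiv v : ℕ)] ℚ_[(primesEquiv v : ℕ)]
          ((adicCompletionIntegers.padicIntEquiv v).toRingEquiv r) := fun r ↦ rfl
  -- `padicEquiv v` maps `W / ℚ_v` to `W / ℚ_[p]` (`ℚ →+* ℚ_[p]` is unique)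
  have hW : (W.baseChange (v.adicCompletion ℚ)).map
      ((adicCompletion.padicEquiv v).toRingEquiv : v.adicCompletion ℚ →+* ℚ_[(primesEquiv v : ℕ)]) =
        W.baseChange ℚ_[(primesEquiv v : ℕ)] := by
    rw [baseChange, baseChange, map_map]
    congr 1
    exact Subsingleton.elim _ _
  haveI : (W.baseChange (v.adicCompletion ℚ)).IsElliptic := by unfold baseChange; infer_instance
  rw [← hW, localTamagawaNumber_map_ringEquiv _ _ hc]

end Padic

end WeierstrassCurve
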